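import Summits.HodgeConjecture.HodgeConjecture.Theses.LinearSystemTorelli
import Literature.AlgebraicGeometry.Motives.BlochSrinivasNullCorrespondence
import Literature.AlgebraicGeometry.HodgeTheory.WeilClassesHodgeType
import Literature.AlgebraicGeometry.HodgeTheory.TopDegreeClasses
import Literature.AlgebraicGeometry.Motives.ClosedGraphMorphism
import Literature.AlgebraicGeometry.Motives.ChowZeroSupportedOnHyperplaneSection
import Literature.AlgebraicGeometry.HodgeTheory.GysinFormalismPushforward

/-!
# Route LinearSystemTorelli — objects the route posits (definitions): the CH₀-null correspondence line

Definitions used by the `--supports` files of the crux `MiddleDivisorSupport`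
(stmt-HodgeConjecture-1081) on the line `ch0-null-correspondence-support` (crux workfile
`Cruxes/MiddleDivisorSupport/Lines/ch0_null_correspondence_support.lean`, crux-plan 2026-08-17; the
six registered stubs of that skeleton are the closed statements `CorrespondencePackagesExist`,
`HodgeIsolatingCorrespondence`, `GeneralizedBlochNilpotence`, `WeilProjectorCoefficients`,
`WeilProjectorNormalForm`, `WeilPontryaginIdentity` below, so that stub files under `Theorems/` can
state them BY NAME — Theorems files cannot import the Cruxes workfile).

The lever of the line (reverse Bloch–Srinivas): if an algebraic self-correspondence `Z` of a smooth
projective `X^{2p}` FIXES a middle Hodge class `c` up to a positive multiple and is CH₀-NULL (its Chow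
action kills a fixed positive multiple of every point class), then Bloch–Srinivas (Voisin II
Cor. 10.20, tree fact `Motives.BlochSrinivas1983_correspondence_nullOnPoints`) and Voisin II (10.8)
(tree `CorrespondenceAction.act_mem_supportedClasses`) put `c` in `N¹H^{2p} = supportedClasses X (2p) 1`.

* ∀X ATTACH FRAME. `pointClass`, `chowAct`, `IsCorrespondencePackage` (ONE pinned pair of actions:
  a Chow action `Act`, Fulton Def. 16.1.2, and a cohomological action `C`, Voisin II (10.7), with
  (K1) Bloch–Srinivas for `Act`, (K2) powers `Z^{∘N}`, (K3) graphs `Γ_f`), and the three frame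
  statements `CorrespondencePackagesExist` (F1, construction debt), `HodgeIsolatingCorrespondence`
  (F2 = HP), `GeneralizedBlochNilpotence` (F3 = GB₀, Voisin II Conj. 11.22 for self-correspondences).
* WEIL-TYPE SECTOR. `weilCharacter`, `IsWeilProjectorCoefficients` (the `K`-type projector onto the
  Weil plane as a `ℤ`-combination of graphs of complex multiplications `x·𝟙 + y·φ`), the `0`-cycle
  vocabulary `endoPointClass`, `pontryaginMonomial`, `weilPontryaginClass`, `weilProjectorOnPoint`
  (Pontryagin monomials `u^{⋆a} ⋆ v^{⋆b}` EXPANDED into point classes `{iP + jφP}`, Bloch 1976), the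
  sector target `WeilClassSupport` (the crux restricted to the rational `(n,n)` classes of the Weil
  plane `weilClassesOf A φ n d`) and the three sector statements `WeilProjectorCoefficients` (S1, pure
  algebra), `WeilProjectorNormalForm` (S2, Beauville–Bloch normal form), `WeilPontryaginIdentity`
  (S3 = (V1_{2n}), theorem for `n ≤ 2`, open from `n = 3`).

These are route-posited STATEMENTS (hypothesis shapes of the line's stubs), not results of the
literature; the theorems about them (the frame composition `F1 → F2 → F3 → MiddleDivisorSupport`, the
sector composition `F1 → S1 → S2 → S3 → WeilClassSupport`, and the stubs that close) live in sibling
proof files `LinearSystemTorelliMiddleDivisorSupport…`. Statements are verbatim those of the registered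
skeleton (sha256 `9ff2d90f140be4ec…`), re-homed to this namespace.

## References

* [Fulton1998] W. Fulton, Intersection Theory, 2nd ed., Def. 16.1.1, Def. 16.1.2, Prop. 16.1.1 (a),
  Prop. 16.1.2 (c), Cor. 16.1.2, Example 19.2.7, §1.3.
* [VoisinHodgeII2003] C. Voisin, Hodge Theory and Complex Algebraic Geometry II, Cor. 10.20, proof of
  Thm. 10.17 (10.7)–(10.8), Prop. 10.24, Conj. 11.22, §11.3.
* [vanGeemen1994HodgeAV] B. van Geemen, An introduction to the Hodge conjecture for abelian
  varieties, 4.8–4.9 and Thm. 6.12.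
* [Bloch1976] S. Bloch, Some elementary theorems about algebraic cycles on Abelian varieties, Thm. 0.1.
* [Beauville1986] A. Beauville, Sur l'anneau de Chow d'une variété abélienne.
* [Moonen2016] B. Moonen, On the Chow motive of an abelian scheme with non-trivial endomorphisms, Thm. 1.
* [Markman2025SurveySecant] E. Markman, Cycles on abelian 2n-folds of Weil type from secant sheaves
  on abelian n-folds, §1.1.
* [Deligne1982HodgeCycles] P. Deligne, Hodge cycles on abelian varieties, Prop. 4.4.
* [Kimura2005FiniteDim] S.-I. Kimura, Chow groups are finite dimensional, in some sense, Prop. 7.5.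
-/

noncomputable section

-- `Summit.HodgeConjecture.HodgeConjecture.Theorems` is the mandated namespace (single-problem summit:
-- Problem = Summit), which `linter.dupNamespace` flags on every declaration; the lakefile turns the
-- linter off tree-wide (weak option), restated here so stand-alone elaboration is warning-free too.
set_option linter.dupNamespace false

namespace Summit.HodgeConjecture.HodgeConjecture.Theorems.Ch0Null

open CategoryTheory AlgebraicGeometry MonoidalCategory
open Literature.AlgebraicGeometry Literature.AlgebraicGeometry.HodgeTheory
open Literature.AlgebraicGeometry.Motives
open Literature.AlgebraicTopology.SingularHomology
open scoped BigOperators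

/-! ### Vocabulary: point classes and the correspondence package -/

/-- The `0`-cycle class `{P} ∈ CH₀(X)` of a complex point `P ∈ X(ℂ)` (its underlying scheme point
`P.pt` is closed, `height_pt_eq_zero`). [cite: Fulton1998, §1.3] -/
def pointClass (X : SchemeOver ℂ) (P : ComplexPoints X) : ChowGroup X.left 0 :=
  ChowGroup.ofPoint P.pt (height_pt_eq_zero P)

/-- The action `Z_* : CH₀(X) →+ CH₀(X)` of a `2p`-cycle `Z` on `X × X` (first factor = source) under a
Chow action `Act` (Fulton Def. 16.1.2). [cite: Fulton1998, Def. 16.1.2] -/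
def chowAct {p : ℕ} {X : SchemeOver ℂ} (Act : CorrespondenceChowAction (2 * p) X X)
    (Z : ↥(cyclesOfDim (X ⊗ X).left (2 * p))) : ChowGroup X.left 0 →+ ChowGroup X.left 0 :=
  Act.act (2 * p) 0 0 rfl (ChowGroup.mk (X ⊗ X).left (2 * p) Z)

/-- **Correspondence package** for a smooth projective `X` of dimension `2p`: a Chow action `Act`
(`α ↦ α_*`, Fulton Def. 16.1.2) and a cohomological action `C` (`Z ↦ [Z]^*`, Voisin II (10.7)) such that
(K1) the Bloch–Srinivas lemma for correspondences null on points holds for `Act` (Voisin II Cor. 10.20,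
tree fact `BlochSrinivas1983_correspondence_nullOnPoints`); (K2) POWERS: every `Z` has, for every
`N ≥ 1`, a cycle `W` ("`Z^{∘N}`") acting as `([Z]^*)^N` on every `Hʳ` and as `(Z_*)^N` on point classes
(Fulton Prop. 16.1.1 (a) / Cor. 16.1.2 with Def. 16.1.2; compatibility of the cycle class with composition,
Fulton Example 19.2.7); (K3) GRAPHS: every endomorphism `f` has a cycle `Γ_f` with `[Γ_f]^* = f^*` on
every `Hʳ` and `(Γ_f)_* {P} = {f(P)}` (Fulton Prop. 16.1.2 (c), Def. 16.1.1). All three hold for the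
intended instance; the package is the explicit list of what the line consumes (one PINNED pair of
actions per `X`, the triage panel's repair of a `∀ Γ` typing).
[cite: Fulton1998, Def. 16.1.1, Def. 16.1.2, Prop. 16.1.1 (a), Prop. 16.1.2 (c), Example 19.2.7]
[cite: VoisinHodgeII2003, Cor. 10.20 and (10.7)] -/
structure IsCorrespondencePackage (p : ℕ) (X : SchemeOver ℂ) (Act : CorrespondenceChowAction (2 * p) X X)
    (C : CorrespondenceAction (2 * p) X) : Prop where
  /-- (K1) Bloch–Srinivas for correspondences null on points (Voisin II Cor. 10.20), for `Act`. -/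
  blochSrinivas : BlochSrinivas1983_correspondence_nullOnPoints Act (2 * p)
  /-- (K2) POWERS `Z^{∘N}`: same `N`-th power action on every `Hʳ(X(ℂ); ℂ)` and on point classes. -/
  powers : ∀ (Z : ↥(cyclesOfDim (X ⊗ X).left (2 * p))) (N : ℕ), 0 < N →
    ∃ W : ↥(cyclesOfDim (X ⊗ X).left (2 * p)),
      (∀ r : ℕ, C.act r W = (C.act r Z) ^ N) ∧
      ∀ P : ComplexPoints X, chowAct Act W (pointClass X P) = (chowAct Act Z)^[N] (pointClass X P)
  /-- (K3) GRAPHS `Γ_f`: `[Γ_f]^* = f^*` on every `Hʳ` and `(Γ_f)_* {P} = {f(P)}`. -/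
  graphs : ∀ f : X ⟶ X, ∃ Γf : ↥(cyclesOfDim (X ⊗ X).left (2 * p)),
      (∀ r : ℕ, C.act r Γf = (complexBetti.map f r).hom) ∧
      ∀ P : ComplexPoints X, chowAct Act Γf (pointClass X P) = pointClass X (AlgPoints.map f P)

/-! ### The ∀X frame: the three statements F1, F2, F3 -/

/-- **F1 — correspondence packages exist** (construction debt; every clause a theorem in print for the
intended instance `Act = α ↦ α_*` of Fulton Def. 16.1.2 and `C = Z ↦ [Z]^*` of Voisin II (10.7); (K1) is
the tree's named fact `BlochSrinivas1983_correspondence_nullOnPoints` for that `Act`). Discharged by the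
cycle-class / intersection-theory construction the whole Hodge programme of the tree owes
(`GysinFormalism.correspondenceAction`, Fulton Ch. 6–8 and 16). A route-posited statement (stub F1 of
the line), not a result of the literature (hence untagged); sources: (Fulton1998, Def. 16.1.2, Prop. 16.1.1 (a), Prop. 16.1.2 (c), Example 19.2.7)
(VoisinHodgeII2003, Cor. 10.20 and proof of Thm. 10.17 (10.7)–(10.8)) -/
def CorrespondencePackagesExist : Prop :=
  ∀ ⦃p : ℕ⦄ ⦃X : SchemeOver ℂ⦄, 1 ≤ p → IsSmoothProjective (2 * p) X →
    ∃ (Act : CorrespondenceChowAction (2 * p) X X) (C : CorrespondenceAction (2 * p) X),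
      IsCorrespondencePackage p X Act C

/-- **F2 — Hodge-isolating correspondences (HP)**: for every package `(Act, C)` of a smooth projective
`X^{2p}` and every rational class `c` of type `(p,p)` there is a `2p`-cycle `Z` on `X × X` with
`[Z]^* c = m · c` for some `m ≥ 1` and `[Z]^* η = 0` for every class `η` of type `(q, 0)`, every `q ≥ 0`.
Implied by the Hodge conjecture for `X × X` (the Hodge projector); a THEOREM where endomorphisms /
automorphisms / Hecke operators cut out the Hodge classes (CM and Weil-type abelian varieties, finite
group quotients, compact Shimura varieties), OPEN in general (Voisin II, discussion of Conj. 11.22 and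
Prop. 10.24). A route-posited statement (stub F2 of the line), not a result of the literature (hence untagged); sources:
(VoisinHodgeII2003, Prop. 10.24 and Conj. 11.22) (vanGeemen1994HodgeAV, proof of Thm. 6.12) -/
def HodgeIsolatingCorrespondence : Prop :=
  ∀ ⦃p : ℕ⦄ ⦃X : SchemeOver ℂ⦄, 1 ≤ p → IsSmoothProjective (2 * p) X →
    ∀ (Act : CorrespondenceChowAction (2 * p) X X) (C : CorrespondenceAction (2 * p) X),
      IsCorrespondencePackage p X Act C →
      ∀ c : complexBetti X (2 * p), IsRationalClass c → IsOfHodgeType (2 * p) X (2 * p) p p c →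
        ∃ (Z : ↥(cyclesOfDim (X ⊗ X).left (2 * p))) (m : ℕ), 0 < m ∧
          C.act (2 * p) Z c = m • c ∧
          ∀ (q : ℕ) (η : complexBetti X q), IsOfHodgeType (2 * p) X q q 0 η → C.act q Z η = 0

/-- **F3 — generalized Bloch nilpotence (GB₀)**: for every package `(Act, C)` of `X^{2p}` and every
`2p`-cycle `Z` on `X × X` whose `[Z]^*` kills all classes of type `(q, 0)` (`q ≥ 0`), the Chow action is
nilpotent on point classes up to ONE positive integer: `M · (Z_*)^N {P} = 0` for all `P ∈ X(ℂ)`.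
This is Voisin II Conj. 11.22 (Bloch–Beilinson for `CH₀`) applied to a self-correspondence; OPEN (the
converse direction of Mumford's theorem, Prop. 10.24). A route-posited statement (stub F3 of the line),
not a result of the literature (hence untagged); sources: (VoisinHodgeII2003, Conj. 11.22 and Prop. 10.24)
(Kimura2005FiniteDim, Prop. 7.5) -/
def GeneralizedBlochNilpotence : Prop :=
  ∀ ⦃p : ℕ⦄ ⦃X : SchemeOver ℂ⦄, 1 ≤ p → IsSmoothProjective (2 * p) X →
    ∀ (Act : CorrespondenceChowAction (2 * p) X X) (C : CorrespondenceAction (2 * p) X),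
      IsCorrespondencePackage p X Act C →
      ∀ Z : ↥(cyclesOfDim (X ⊗ X).left (2 * p)),
        (∀ (q : ℕ) (η : complexBetti X q), IsOfHodgeType (2 * p) X q q 0 η → C.act q Z η = 0) →
        ∃ (N M : ℕ), 0 < N ∧ 0 < M ∧
          ∀ P : ComplexPoints X, M • ((chowAct Act Z)^[N] (pointClass X P)) = 0

/-! ### The Weil-type SECTOR: vocabulary -/

section WeilSector

/-- The character `(x + y·i·√d)ᵃ (x - y·i·√d)ᵇ` by which the endomorphism `x·𝟙_A + y·φ` (`φ² = -d`)
pulls back a class of `K`-type `(a, b)` (`⋀ᵃ V₊ ⊗ ⋀ᵇ V₋ ⊆ H^{a+b}(A(ℂ); ℂ)`, van Geemen 4.8–4.9; the two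
Weil characters of `HodgeTheory.weilClassesPlus/Minus` are the cases `(2n, 0)`, `(0, 2n)`).
[cite: vanGeemen1994HodgeAV, 4.8–4.9] -/
def weilCharacter (d x y a b : ℕ) : ℂ :=
  ((x : ℂ) + (y : ℂ) * Complex.I * (Real.sqrt d : ℂ)) ^ a *
    ((x : ℂ) - (y : ℂ) * Complex.I * (Real.sqrt d : ℂ)) ^ b

/-- **Weil-projector coefficients**: integers `q(x, y)` (finitely many non-zero) and `m` such that
`Σ q(x,y) · (x + yi√d)ᵃ (x - yi√d)ᵇ = m · 𝟙_S(a, b)` on the grid `0 ≤ a, b ≤ 2n`, `S = {(2n,0),(0,2n)}`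
— i.e. the cycle `Z_q = Σ q(x,y) Γ_{x·𝟙+y·φ}` acts on the `K`-type `(a, b)` piece of `H^•(A)` by
`m · 𝟙_S(a,b)`: `m` times the projector onto the Weil plane (cf. van Geemen, proof of Thm. 6.12: the Weil
classes are cut out by the `K^×`-multiplications). [cite: vanGeemen1994HodgeAV, proof of Thm. 6.12] -/
def IsWeilProjectorCoefficients (n d : ℕ) (q : ℕ × ℕ →₀ ℤ) (m : ℕ) : Prop :=
  ∀ a b : ℕ, a ≤ 2 * n → b ≤ 2 * n →
    (∑ xy ∈ q.support, (q xy : ℂ) * weilCharacter d xy.1 xy.2 a b) =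
      if (a = 2 * n ∧ b = 0) ∨ (a = 0 ∧ b = 2 * n) then (m : ℂ) else 0

variable (A : AbelianVariety ℂ) (φ : A ⟶ A)

/-- The `0`-cycle class `{(x·𝟙_A + y·φ)(P)} ∈ CH₀(A)` of the image of a complex point `P` under the
endomorphism `x·𝟙_A + y·φ ∈ ℕ[φ] ⊆ End(A)` (in the group law: the point `x·P + y·φ(P)`).
[cite: Bloch1976, §1] -/
def endoPointClass (x y : ℕ) (P : A.Points ℂ) : ChowGroup A.X.left 0 :=
  pointClass A.X (AlgPoints.map (x • 𝟙 A + y • φ).hom.hom.hom P)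

/-- **The Pontryagin monomial `u^{⋆a} ⋆ v^{⋆b} ∈ CH₀(A)`**, `u = {P} - {0}`, `v = {φ(P)} - {0}`
(`⋆` = Pontryagin product on `0`-cycles of the abelian variety), EXPANDED into point classes:
`Σ_{i ≤ a, j ≤ b} (-1)^{(a-i)+(b-j)} C(a,i) C(b,j) {i·P + j·φ(P)}` (since `{P} ⋆ {Q} = {P + Q}`). Bloch's
theorem `I^{⋆(g+1)} = 0` says these vanish for `a + b > dim A`. [cite: Bloch1976, Thm. 0.1] -/
def pontryaginMonomial (P : A.Points ℂ) (a b : ℕ) : ChowGroup A.X.left 0 :=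
  ∑ i ∈ Finset.range (a + 1), ∑ j ∈ Finset.range (b + 1),
    ((-1 : ℤ) ^ (a - i + (b - j)) * (a.choose i : ℤ) * (b.choose j : ℤ)) • endoPointClass A φ i j P

/-- **The Weil–Pontryagin class `W_{2n}(P) = Σ_{i ≤ n} (-1)ⁱ C(2n, 2i) d^{n-i} · u^{⋆(2n-2i)} ⋆ v^{⋆ 2i}
∈ CH₀(A)`** — the rational form of `ℓ′^{⋆2n} + ℓ″^{⋆2n}` (`ℓ = log_⋆{P} = ℓ′ + ℓ″` the
`φ_*`-eigen-decomposition), i.e. of the `K`-holomorphic part of the top Beauville piece `CH₀^{(2n)}(A)`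
generated by `P`: `n = 2`: `d²u⁴ - 6d u²v² + v⁴`; `n = 3`: `d³u⁶ - 15d²u⁴v² + 15d u²v⁴ - v⁶`.
[cite: Beauville1986, Thm.] [cite: Bloch1976, Thm. 0.1] -/
def weilPontryaginClass (n d : ℕ) (P : A.Points ℂ) : ChowGroup A.X.left 0 :=
  ∑ i ∈ Finset.range (n + 1),
    ((-1 : ℤ) ^ i * ((2 * n).choose (2 * i) : ℤ) * (d : ℤ) ^ (n - i)) •
      pontryaginMonomial A φ P (2 * n - 2 * i) (2 * i)

/-- The action on the point `P` of the Weil projector cycle with coefficients `q`: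
`Σ q(x,y) {(x·𝟙 + y·φ)(P)} ∈ CH₀(A)` (`= (Z_q)_* {P}` for `Z_q = Σ q(x,y) Γ_{x·𝟙+y·φ}`, by (K3)).
[cite: Fulton1998, Prop. 16.1.2 (c)] -/
def weilProjectorOnPoint (q : ℕ × ℕ →₀ ℤ) (P : A.Points ℂ) : ChowGroup A.X.left 0 :=
  ∑ xy ∈ q.support, q xy • endoPointClass A φ xy.1 xy.2 P

variable {A φ}

/-! ### The Weil-type SECTOR: target and three statements S1, S2, S3 -/

/-- **SECTOR TARGET `WeilClassSupport` = the crux `MiddleDivisorSupport` restricted to Weil classes**: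
for a complex abelian variety `A` of dimension `2n` (`n ≥ 1`) with `φ ≫ φ = -d` (`d ≥ 1`), every
RATIONAL class of Hodge type `(n, n)` in the Weil plane `weilClassesOf A φ n d ⊆ H²ⁿ(A(ℂ); ℂ)` is
supported on a divisor. A restriction of the crux; for `n = 2` a theorem (Markman 2025, tree fact
`Markman2025_weilClasses_algebraic_abelianFourfold`: even algebraic); OPEN for `n ≥ 3` in general.
A route-posited statement (the sector target of the line), not a result of the literature (hence untagged); sources:
(Markman2025SurveySecant, §1.1) (vanGeemen1994HodgeAV, 1.1 and 4.9) -/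
def WeilClassSupport : Prop :=
  ∀ (A : AbelianVariety ℂ) (φ : A ⟶ A) (n d : ℕ), 0 < n → 0 < d → A.dim = 2 * n →
    φ ≫ φ = -(d • 𝟙 A) →
    ∀ c ∈ weilClassesOf A φ n d, IsRationalClass c → IsOfHodgeType (2 * n) A.X (2 * n) n n c →
      c ∈ supportedClasses A.X (2 * n) 1

/-- **S1 — Weil-projector coefficients exist** (pure algebra): for `n, d ≥ 1` there are
`q : ℕ × ℕ →₀ ℤ` and `m ≥ 1` with `Σ q(x,y)(x + yi√d)ᵃ(x - yi√d)ᵇ = m·𝟙_S(a,b)` on `0 ≤ a, b ≤ 2n`.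
(The monomials `zᵃwᵇ` are linearly independent on the Zariski-dense image of `ℕ²` under
`(x,y) ↦ (x+yi√d, x-yi√d)`; the functional "coefficient of `z^{2n}` plus coefficient of `w^{2n}`" is
`2^{1-2n}(-d)^{-n} Σᵢ (-d)ⁱ·[x^{2i}y^{2n-2i}]`, a rational combination of monomial coefficients, hence of
evaluations at the grid `[0,4n]²` (Vandermonde); clear denominators.) A route-posited statement (stub
S1 of the line), untagged; cf. (vanGeemen1994HodgeAV, proof of Thm. 6.12). -/
def WeilProjectorCoefficients : Prop :=
  ∀ n d : ℕ, 0 < n → 0 < d → ∃ (q : ℕ × ℕ →₀ ℤ) (m : ℕ), 0 < m ∧ IsWeilProjectorCoefficients n d q m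

/-- **S2 — Beauville–Bloch normal form of the Weil projector on `0`-cycles**: for `(A, φ)` with
`dim A = 2n`, `φ² = -d`, and Weil-projector coefficients `(q, m)`, the `0`-cycle `Σ q(x,y){(x·𝟙 + y·φ)(P)}`
is, up to non-zero integer factors, the Weil–Pontryagin class `W_{2n}(P)`:
`M₁ · Σ q(x,y){(x·𝟙+y·φ)(P)} = M₂ · W_{2n}(P)` in `CH₀(A)` with `M₁ ≥ 1` (uniformly in `P`; in print
`M₁ = 2^{2n-1}dⁿ(2n)!`, `M₂ = m`). Follows from Bloch's `I^{⋆(2n+1)} = 0` by the binomial expansion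
`{xP + yφP} ↔ sˣtʸ = (1+u)ˣ(1+v)ʸ` and the character sums of `IsWeilProjectorCoefficients` in degrees
`≤ 2n`. A route-posited statement (stub S2 of the line), untagged; cf. (Bloch1976, Thm. 0.1), (Beauville1986, Thm.). -/
def WeilProjectorNormalForm : Prop :=
  ∀ (A : AbelianVariety ℂ) (φ : A ⟶ A) (n d : ℕ), 0 < n → 0 < d → A.dim = 2 * n →
    φ ≫ φ = -(d • 𝟙 A) →
    ∀ (q : ℕ × ℕ →₀ ℤ) (m : ℕ), 0 < m → IsWeilProjectorCoefficients n d q m →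
      ∃ (M₁ : ℕ) (M₂ : ℤ), 0 < M₁ ∧
        ∀ P : A.Points ℂ, M₁ • weilProjectorOnPoint A φ q P = M₂ • weilPontryaginClass A φ n d P

/-- **S3 — THE WEIL–PONTRYAGIN IDENTITY (V1_{2n})**: on an abelian variety of balanced Weil type
`(n, n)` (`dim A = 2n`, `φ² = -d`, `φ^*` has the eigenvalue `i√d` on `H^{1,0}` with multiplicity `n` —
the hypothesis under which the Weil classes are Hodge classes, Deligne–Milne Prop. 4.4), the
Weil–Pontryagin class of every point is torsion of bounded order: `M · W_{2n}(P) = 0` in `CH₀(A)`, one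
`M ≥ 1` for all `P` ("the top Beauville piece of `CH₀(A)` has no `K`-holomorphic part":
`CH₀(det_K h¹(A)) = 0`). THEOREM for `n = 1` and `n = 2` (Hodge conjecture for the Weil classes +
O'Sullivan + Kimura finite-dimensionality + Roitman); OPEN from `n = 3` in general (Moonen 2016:
"almost nothing seems known"; Markman 2025 gives the Weil classes on sixfolds of discriminant `-1`).
A route-posited statement (stub S3 of the line, its hardest), not a result of the literature (hence untagged); sources:
(Moonen2016, Thm. 1) (Markman2025SurveySecant, §1.1) (Deligne1982HodgeCycles, Prop. 4.4)
(Kimura2005FiniteDim, Prop. 7.5) -/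
def WeilPontryaginIdentity : Prop :=
  ∀ (A : AbelianVariety ℂ) (φ : A ⟶ A) (n d : ℕ), 0 < n → 0 < d → (hA : A.dim = 2 * n) →
    φ ≫ φ = -(d • 𝟙 A) →
    Module.finrank ℂ ↥(Module.End.eigenspace (complexBetti.map φ.hom.hom.hom 1).hom
          (Complex.I * (Real.sqrt d : ℂ)) ⊓
        hodgeOneZero (isSmoothProjective_of_dim_eq' hA)) = n →
    ∃ M : ℕ, 0 < M ∧ ∀ P : A.Points ℂ, M • weilPontryaginClass A φ n d P = 0


/-- **The sector target is a restriction of the crux**: `MiddleDivisorSupport` (all smooth projective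
`2p`-folds, all rational middle `(p,p)`-classes) gives `WeilClassSupport` (abelian `2n`-folds, the
rational `(n,n)` classes of a Weil plane) — instantiate at `X = A.X`, `p = n`
(`isSmoothProjective_of_dim_eq'`). Registered sub-goal `weilClassSupport_of_middleDivisorSupport` of
stmt-HodgeConjecture-1081 (the Defs file's creditable theorem). -/
theorem weilClassSupport_of_middleDivisorSupport : Summit.HodgeConjecture.HodgeConjecture.Theses.LinearSystemTorelli.MiddleDivisorSupport → WeilClassSupport := by
  intro h A φ n d hn _ hA _ c _ hc hH
  exact h hn (isSmoothProjective_of_dim_eq' hA) c hc hH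

/-! ### The sector's lean: Bloch's theorem `I^{⋆(g+1)} = 0` on the pair `(P, φP)` (appended r1) -/

/-- **Bloch's theorem `I^{⋆(g+1)} = 0` on the pair `(P, φP)`** — the LEAN of the sector (an instance of
a published theorem the line assumes by name, NOT a stub and not a route-posited bet): for an abelian
variety `A` over `ℂ` of dimension `g`, an endomorphism `φ` and a complex point `P`, the Pontryagin
monomial `u^{⋆a} ⋆ v^{⋆b}` (`u = {P} - {0}`, `v = {φP} - {0}`), expanded into the point classes
`{iP + jφP}` (`pontryaginMonomial`), VANISHES in `CH₀(A)` as soon as `a + b > g` (Bloch 1976, Thm. 0.1: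
the `(g+1)`-st Pontryagin power of the augmentation ideal of `CH₀(A)` is zero over an algebraically
closed field; integrally, by Roitman's theorem on `ker alb ⊇ I^{⋆2}`). Discharge route: Bloch 1976
Thm. 0.1 stated on the tree's carriers (points `A.Points ℂ` with their group law, `ChowGroup.ofPoint`)
as a Literature fact, plus the bridge `{(i·𝟙 + j·φ)P} = {P^i · φ(P)^j}` (`MonObj.comp_mul`,
`AbelianVariety.hom_add`). Untagged here (route-side rendering of the hypothesis the reshaped stub
`stub_weilProjectorNormalForm_of_bloch : BlochPontryaginVanishing → WeilProjectorNormalForm` consumes);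
source: (Bloch1976, Thm. 0.1). -/
def BlochPontryaginVanishing : Prop :=
  ∀ (A : AbelianVariety ℂ) (φ : A ⟶ A) (P : A.Points ℂ) (a b : ℕ), A.dim < a + b →
    pontryaginMonomial A φ P a b = 0

/-- The form in which stub S2 consumes the lean: on `A` of dimension `2n`, every Pontryagin monomial
`u^{⋆a} ⋆ v^{⋆b}` with `a + b > 2n` vanishes. Registered sub-goal
`pontryaginMonomial_eq_zero_of_dim` of stmt-HodgeConjecture-1081. -/
theorem pontryaginMonomial_eq_zero_of_dim : BlochPontryaginVanishing → ∀ (A : AbelianVariety ℂ) (φ : A ⟶ A) (n : ℕ), A.dim = 2 * n → ∀ (P : A.Points ℂ) (a b : ℕ), 2 * n < a + b → pontryaginMonomial A φ P a b = 0 := by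
  intro hB A φ n hA P a b hab
  exact hB A φ P a b (hA ▸ hab)

end WeilSector

end Summit.HodgeConjecture.HodgeConjecture.Theorems.Ch0Null

end
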